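import Summits.AtomisticToContinuum.BoseEinsteinCondensation.Theses.BECStronglyRayleigh
import Literature.Combinatorics.StablePolynomials.KernelForm
import Literature.Combinatorics.StablePolynomials.ElementarySymmetric
import Literature.MathematicalPhysics.QuantumLattice.SpinChainsLiebMattisProofs
import Literature.MathematicalPhysics.QuantumLattice.TokenSliding
import Literature.LinearAlgebra.Matrix.PrimitiveSymmetricPerron
import Literature.LinearAlgebra.Matrix.NonnegSymmetricTraceLimit

/-!
# Line `six-vertex-euler-gates` — crux `BECStronglyRayleigh.GroundStateStability`
# (stmt-AtomisticToContinuum-9672)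

Skeleton (crux-plan, round 1) of the idea card `six-vertex-euler-gates` (crux-ideate k1; triage r1-1:
pass, with the cross-seat duplicate `euler-bond-sweep-perron` folded in and the triager's sharpening
"take the sweep in GRAM form" adopted).

THE LINE. The crux says: every magnetisation-sector ground vector `ψ` of
`H = xxzHamiltonian 1 G (-1) Δ + Σ_x μ_x Sᶻ_x` (`G` finite connected, `|Δ| ≤ 1`, `μ` arbitrary real)
has an upper-half-plane stable amplitude polynomial `Σ_S ψ(1_S) z^S`. Instead of the imaginary-time
semigroup `e^{-τH}` (Matrix.exp, Lie–Trotter, `τ → ∞`) the line uses ONE first-order (Euler) sweep: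

* the EULER BOND GATE `T_e(ε) = 1 + ε (SˣSˣ + SʸSʸ + Δ SᶻSᶻ)_e = 1 - ε h_e` acts on the bond monomials
  `{z_x z_y, z_x, z_y, 1}` with six-vertex weights `a = 1 + εΔ/4` (frozen), `b = 1 - εΔ/4` (stay),
  `c = ε/2` (hop); its Borcea–Brändén symbol is `G_e · Π_{i ≠ x,y} (z_i + w_i)` with
  `G_e = a (z_x z_y + w_x w_y) + b (z_x w_y + z_y w_x) + c (z_x w_x + z_y w_y) = ½ uᵀQu`, whose Hessian `Q`
  has the Klein-character eigenvalues `a+b+c, a-b-c, b-a-c, c-a-b`; `G_e` is stable iff `Q` is Lorentzian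
  iff `(a,b,c)` satisfy the triangle inequalities iff `|Δ| ≤ 1` (for `0 < ε ≤ 4`) — the disordered regime of
  the six-vertex model. So `T_e(ε)` is a stability preserver exactly in the crux's window
  (`stub_eulerGateSymbol`, the load-bearing stub; BB Lemma 2.2 sufficiency is PROVED in tree:
  `Literature.Combinatorics.StablePolynomials.multiAffine_kernel_stable_or_zero`);
* the field gate `F_ε = e^{-ε Σ μ_x Sᶻ_x}` is an explicit positive DIAGONAL matrix of product form, i.e.
  a positive rescaling of the variables (`IsUpperHalfPlaneStable.diagScale`), any `μ`, no smallness;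
* the GRAM SWEEP `A_ε = B_εᴴ B_ε`, `B_ε = F_ε · Π_{e ∈ E(G)} T_e(ε)`, is a stability preserver
  (`stub_gramPreserves`), entrywise nonnegative, positive-diagonal, Hermitian PSD, sector-preserving and
  token-irreducible on each sector of a connected graph (`stub_gramStoquastic`);
* hence its sector Perron vector `φ_ε` is amplitude-stable (`stub_perronStable`: PSD nonneg irreducible
  preserver ⇒ Perron vector in the closed stable cone; power iteration from the stable seed `e_N`
  (`isUpperHalfPlaneStable_esymm`) or the variational selection lemma of card
  `stable-cone-variational-selection`; Hurwitz `eq_zero_or_isUpperHalfPlaneStable_of_mem_closure`);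
* `A_ε = 1 - 2εH + O(ε²)`, so the unit top eigenvectors `φ_ε` accumulate, as `ε → 0⁺`, only at unit
  sector ground vectors of `H` (`stub_perronLimit`, first-order perturbation / Rayleigh quotients);
* Hurwitz once more (proved below, `ampStable_of_tendsto`) makes that limit ground vector stable, and
  Perron–Frobenius uniqueness of the sector ground ray of the stoquastic `H` on a connected graph
  (`stub_sectorGroundUnique`) transfers stability to EVERY sector ground vector `ψ = c φ_∞`.

No `Matrix.exp`, no Lie–Trotter, no `τ → ∞`; exactly one limit (`ε → 0⁺`).

Composition (sorry-free, kernel-checked): `GroundStateStability_of` takes the six registered stubs (keyed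
BY NAME through the `Registered.stub_*` aliases, the device of
`CriticalPhenomena/CardyFormulaZ2/Cruxes/LagHandOff/Lines/crosscut-dictionary.lean`) and concludes
`Summit.AtomisticToContinuum.BoseEinsteinCondensation.Theses.BECStronglyRayleigh.GroundStateStability` BY NAME;
the final `example` wires the actual stubs in.

WHERE THE CRUX'S HYPOTHESES ARE USED (Disproof obligations, self-audited — the refuter's `Disproof.lean`
is not mounted in this jail and none is published under `Cruxes/GroundStateStability/`):
`|Δ| ≤ 1` enters ONLY at `stub_eulerGateSymbol` (and is false without it: Rayleigh violations at
`|Δ| = 1.05`, item evidence); `G.Connected` enters at `stub_gramStoquastic` (irreducibility),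
`stub_perronStable` and `stub_sectorGroundUnique` (and is false without it: `G = K₂ ⊔ K₂`, `Δ = 1`,
`μ = 0`, `N = 2` has the ground vector `z₁z₂ + z₃z₄`, which vanishes at
`z = (e^{iπ/4}, e^{iπ/4}, e^{3iπ/4}, e^{3iπ/4}) ∈ H⁴`); the ground-state equation and `ψ ∈ 𝓗_M` are consumed
by `stub_sectorGroundUnique` inside `GroundStateStability_of`; `ψ ≠ 0` gives `𝓗_M ≠ ⊥` and `c ≠ 0`.
-/

noncomputable section

namespace Summit.AtomisticToContinuum.BoseEinsteinCondensation.Cruxes.GroundStateStability.SixVertexEulerGates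

open scoped BigOperators Topology Matrix ComplexConjugate
open Filter Matrix Finset
open Literature.MathematicalPhysics.QuantumLattice
open Literature.Combinatorics.StablePolynomials
open Summit.AtomisticToContinuum.BoseEinsteinCondensation.Theses.BECStronglyRayleigh (GroundStateStability)

variable {Λ : Type*} [Fintype Λ] [DecidableEq Λ]

/-! ## Objects of the line -/

/-- The occupation configuration of `S ⊆ Λ`: index `0` (= spin up = boson present) on `S`, index `1` off
`S` — literally the crux's `fun x => if x ∈ S then 0 else 1`. -/
def ind (S : Finset Λ) : TensorIndex Λ 2 := fun x => if x ∈ S then 0 else 1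

/-- The amplitude family `S ↦ ψ(1_S)` of a spin-½ vector (the coefficients of its generating polynomial). -/
def amp (ψ : TensorIndex Λ 2 → ℂ) : Finset Λ → ℂ := fun S => ψ (ind S)

/-- Upper-half-plane stability of the multi-affine polynomial `Σ_S a(S) z^S`, in the crux's inline form
(`= IsUpperHalfPlaneStable (multiAffine a)` by `isUpperHalfPlaneStable_multiAffine_iff`). -/
def AmpStable (a : Finset Λ → ℂ) : Prop :=
  ∀ z : Λ → ℂ, (∀ x, 0 < (z x).im) → (∑ S : Finset Λ, a S * ∏ x ∈ S, z x) ≠ 0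

/-- The kernel of an operator on `ℂ^{(Λ → Fin 2)}` read on occupation configurations:
`K_A(S', S) = ⟨1_{S'}| A |1_S⟩`, so that `amp (A ψ) = K_A · amp ψ`. -/
def kernelOf (A : Op Λ 2) (S' S : Finset Λ) : ℂ := A (ind S') (ind S)

/-- The Hamiltonian of the crux: `xxzHamiltonian 1 G (-1) Δ + Σ_x μ_x Sᶻ_x` (verbatim). -/
def ham (G : SimpleGraph Λ) [DecidableRel G.Adj] (Δ : ℝ) (μ : Λ → ℝ) : Op Λ 2 :=
  xxzHamiltonian 1 G (-1) Δ + ∑ x : Λ, ((μ x : ℝ) : ℂ) • siteSpin 1 x 2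

/-- The bond operator `h⁺_e = Sˣ_xSˣ_y + Sʸ_xSʸ_y + Δ Sᶻ_xSᶻ_y` on an unordered pair `e = s(x, y)` (the
summand of `xxzHamiltonian 1 G J Δ`, which is `J • Σ_e h⁺_e`; here `J = -1`). -/
def bondOp (Δ : ℝ) : Sym2 Λ → Op Λ 2 :=
  Sym2.lift ⟨fun x y => spinBond 1 0 x y + spinBond 1 1 x y + (Δ : ℂ) • spinBond 1 2 x y,
    fun x y => by simp only [spinBond_comm]⟩

/-- **The Euler bond gate** `T_e(ε) = 1 + ε h⁺_e = 1 - ε h_e` (`h_e = -h⁺_e` the ferromagnetic bond of `H`):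
on the bond monomials it has the six-vertex weights `a = 1 + εΔ/4`, `b = 1 - εΔ/4`, `c = ε/2`. -/
def eulerGate (Δ ε : ℝ) (e : Sym2 Λ) : Op Λ 2 := 1 + (ε : ℂ) • bondOp Δ e

/-- **The field gate** `F_ε = e^{-ε Σ_x μ_x Sᶻ_x}`, written as the explicit positive diagonal matrix
`diag(exp(-ε Σ_x μ_x (½ - σ_x)))` (no `Matrix.exp`); on amplitude families it is the product-form
rescaling `a(S) ↦ e^{ε Σμ/2} (Π_{x∈S} e^{-εμ_x}) a(S)`. -/
def fieldGate (μ : Λ → ℝ) (ε : ℝ) : Op Λ 2 :=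
  Matrix.diagonal fun σ => ((Real.exp (-(ε * ∑ x : Λ, μ x * (1 / 2 - ((σ x : ℕ) : ℝ)))) : ℝ) : ℂ)

/-- **One Euler sweep** `B_ε = F_ε · Π_{e ∈ E(G)} T_e(ε)`, the bond gates in the (arbitrary but fixed) order
of `G.edgeFinset.toList`; `B_ε = 1 - εH + O(ε²)`. -/
def sweep (G : SimpleGraph Λ) [DecidableRel G.Adj] (Δ : ℝ) (μ : Λ → ℝ) (ε : ℝ) : Op Λ 2 :=
  fieldGate μ ε * (G.edgeFinset.toList.map (eulerGate Δ ε)).prod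

/-- **The Gram (palindromic) sweep** `A_ε = B_εᴴ B_ε`: Hermitian, positive semidefinite, a word in the
gates (each gate is Hermitian), and `A_ε = 1 - 2εH + O(ε²)`. -/
def gram (G : SimpleGraph Λ) [DecidableRel G.Adj] (Δ : ℝ) (μ : Λ → ℝ) (ε : ℝ) : Op Λ 2 :=
  (sweep G Δ μ ε)ᴴ * sweep G Δ μ ε

/-! ## The six statements of the line -/

/-- STATEMENT 1 (load-bearing; the only place where `|Δ| ≤ 1` enters). The Borcea–Brändén symbol of the
Euler bond gate, in the kernel form consumed by `multiAffine_kernel_stable_or_zero`, has no zero with all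
`Im zᵢ, Im wᵢ > 0`, for `|Δ| ≤ 1` and `0 < ε ≤ 4`. Content: `K(S',S) = ⟨1_{S'}|T_{xy}(ε)|1_S⟩` is the
identity off `{x,y}` and the `4 × 4` six-vertex block on `{x,y}`, so the symbol factorises as
`G_{xy}(z_x,z_y,w_x,w_y) · Π_{i∉{x,y}} (zᵢ + wᵢ)` with `G_{xy} = a(z_xz_y + w_xw_y) + b(z_xw_y + z_yw_x)
+ c(z_xw_x + z_yw_y)`, `a = 1+εΔ/4, b = 1-εΔ/4, c = ε/2 ≥ 0`, Hessian eigenvalues `a+b+c > 0 ≥ a-b-c,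
b-a-c, c-a-b` (⟺ `Δ ≤ 1`, `Δ ≥ -1`, `ε ≤ 4`); a nonzero entrywise-nonnegative quadratic form with exactly
one positive eigenvalue is `H`-stable (`q(v+iy) = q(v) - q(y) + 2iB(v,y)`, `q(y) > 0`, and `B(v,y) = 0 =
q(v) - q(y)` would make `q` positive definite on `span{v,y}`). -/
def EulerGateSymbolStable : Prop :=
  ∀ (Λ : Type) [Fintype Λ] [DecidableEq Λ] (x y : Λ), x ≠ y → ∀ (Δ ε : ℝ), |Δ| ≤ 1 → 0 < ε → ε ≤ 4 →
    ∀ z w : Λ → ℂ, (∀ i, 0 < (z i).im) → (∀ i, 0 < (w i).im) →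
      (∑ S : Finset Λ, (∑ S' : Finset Λ, kernelOf (eulerGate Δ ε s(x, y)) S' S * ∏ i ∈ S', z i) *
        ∏ i ∈ Sᶜ, w i) ≠ 0

/-- STATEMENT 2. The Gram sweep is a stability preserver on amplitude families: for `|Δ| ≤ 1`,
`0 < ε ≤ 1` and every `H^Λ`-stable family `a`, the family `K_{A_ε} a` is identically `0` or again stable.
Content: `kernelOf` turns matrix products into kernel composition (`ind : Finset Λ ≃ (Λ → Fin 2)`), the
conjugate transpose of the sweep is the reversed word (every gate is Hermitian), each bond gate preserves
stability-or-zero by STATEMENT 1 + `multiAffine_kernel_stable_or_zero` (BB Lemma 2.2, proved in tree),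
and the field gate is `IsUpperHalfPlaneStable.diagScale`; induction on the word. -/
def GramPreservesStability : Prop :=
  ∀ (Λ : Type) [Fintype Λ] [DecidableEq Λ] (G : SimpleGraph Λ) [DecidableRel G.Adj] (Δ : ℝ)
    (μ : Λ → ℝ), |Δ| ≤ 1 → ∀ ε : ℝ, 0 < ε → ε ≤ 1 → ∀ a : Finset Λ → ℂ, AmpStable a →
      (∀ S' : Finset Λ, ∑ S : Finset Λ, kernelOf (gram G Δ μ ε) S' S * a S = 0) ∨
        AmpStable (fun S' => ∑ S : Finset Λ, kernelOf (gram G Δ μ ε) S' S * a S)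

/-- STATEMENT 3. Stoquasticity and ergodicity of the Gram sweep (`|Δ| ≤ 1`, `0 < ε ≤ 1`): real
nonnegative entries, strictly positive diagonal, block-diagonal in the magnetisation (`A_ε` commutes with
`Sᶻ_tot`: every gate does), and — for connected `G` — irreducible on each magnetisation sector (the
positivity graph of `A_ε` contains every single hop of a token along an edge, weight `≥ ε/2 ·`(diagonals),
and token sliding is connected: `TokenSliding.exists_slide_out`). Hermitian/PSD are free from `A = BᴴB`. -/
def GramStoquastic : Prop :=
  ∀ (Λ : Type) [Fintype Λ] [DecidableEq Λ] (G : SimpleGraph Λ) [DecidableRel G.Adj] (Δ : ℝ)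
    (μ : Λ → ℝ), |Δ| ≤ 1 → ∀ ε : ℝ, 0 < ε → ε ≤ 1 →
      (∀ σ τ : TensorIndex Λ 2, 0 ≤ (gram G Δ μ ε σ τ).re ∧ (gram G Δ μ ε σ τ).im = 0) ∧
      (∀ σ : TensorIndex Λ 2, 0 < (gram G Δ μ ε σ σ).re) ∧
      (∀ σ τ : TensorIndex Λ 2, mag 1 σ ≠ mag 1 τ → gram G Δ μ ε σ τ = 0) ∧
      (G.Connected → ∀ σ τ : TensorIndex Λ 2, mag 1 σ = mag 1 τ →
        Relation.ReflTransGen (fun α β => gram G Δ μ ε α β ≠ 0) σ τ)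

/-- STATEMENT 4 (from STATEMENTS 2–3). The sector Perron vector of the Gram sweep is amplitude-stable: for
connected `G`, `|Δ| ≤ 1`, `0 < ε ≤ 1` and a nonzero sector `𝓗_M` there is a unit, entrywise nonnegative
`φ ∈ 𝓗_M` maximising the Rayleigh quotient of `A_ε` over `𝓗_M` whose amplitude polynomial is stable.
Content: restrict `A_ε` to the configurations of magnetisation `M` (STATEMENT 3: nonnegative symmetric,
positive diagonal, irreducible ⇒ some power entrywise positive, `exists_pow_apply_pos`); Perron
(`exists_pos_eigenvector_of_pow_pos`, simplicity `card_filter_eigenvalues_eq_topEigenvalue_eq_one_of_pow_pos`,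
PSD ⇒ no `-λ_max`); the stable cone `{v ≥ 0 : amp v stable} ∪ {0}` is closed (Hurwitz,
`eq_zero_or_isUpperHalfPlaneStable_of_mem_closure`), contains the seed `e_N` (`isUpperHalfPlaneStable_esymm`)
and is mapped into itself minus `0` by `A_ε` (STATEMENT 2 + positive diagonal), so power iteration from
`e_N` (or the Cauchy–Schwarz moment-chain selection lemma of card `stable-cone-variational-selection`)
puts the Perron vector in the cone. -/
def PerronVectorStable : Prop :=
  ∀ (Λ : Type) [Fintype Λ] [DecidableEq Λ] (G : SimpleGraph Λ) [DecidableRel G.Adj], G.Connected →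
    ∀ (Δ : ℝ) (μ : Λ → ℝ), |Δ| ≤ 1 → ∀ ε : ℝ, 0 < ε → ε ≤ 1 → ∀ M : ℝ,
      spinZSector (Λ := Λ) 1 M ≠ ⊥ →
      ∃ φ : TensorIndex Λ 2 → ℂ, φ ∈ spinZSector (Λ := Λ) 1 M ∧
        (∀ σ, 0 ≤ (φ σ).re ∧ (φ σ).im = 0) ∧ star φ ⬝ᵥ φ = 1 ∧
        (∀ v ∈ spinZSector (Λ := Λ) 1 M,
          (star v ⬝ᵥ gram G Δ μ ε *ᵥ v).re ≤ (star φ ⬝ᵥ gram G Δ μ ε *ᵥ φ).re * (star v ⬝ᵥ v).re) ∧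
        AmpStable (amp φ)

/-- STATEMENT 5 (no window, no connectedness needed). Top eigenvectors of the Gram sweeps accumulate at
sector ground vectors: if `0 < εₙ ≤ 1`, `εₙ → 0`, and `φₙ ∈ 𝓗_M` are unit vectors maximising the Rayleigh
quotient of `A_{εₙ}` over `𝓗_M`, then a subsequence converges to a unit `φ_∞ ∈ 𝓗_M` with
`H φ_∞ = E_min(M) φ_∞`. Content: compactness of the unit sphere; `‖A_ε - (1 - 2εH)‖ ≤ Cε²` for `ε ≤ 1`
(expand the word `B_ε = F_ε Π T_e(ε)` and `F_ε = 1 - ε Σμ_xSᶻ_x + O(ε²)`), whence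
`⟨φₙ, Hφₙ⟩ ≤ ⟨v, Hv⟩ + Cεₙ` for every unit `v ∈ 𝓗_M`; the limit minimises the quadratic form of the
Hermitian, `𝓗_M`-invariant `H` on `𝓗_M`, so it is an eigenvector for `lowestEnergyInSector`
(`Matrix.minEnergyOn` is that minimum, attained). -/
def PerronLimit : Prop :=
  ∀ (Λ : Type) [Fintype Λ] [DecidableEq Λ] (G : SimpleGraph Λ) [DecidableRel G.Adj] (Δ : ℝ)
    (μ : Λ → ℝ) (M : ℝ) (ε : ℕ → ℝ), (∀ n, 0 < ε n ∧ ε n ≤ 1) → Tendsto ε atTop (𝓝 0) →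
    ∀ φ : ℕ → TensorIndex Λ 2 → ℂ,
      (∀ n, φ n ∈ spinZSector (Λ := Λ) 1 M ∧ star (φ n) ⬝ᵥ φ n = 1 ∧
        ∀ v ∈ spinZSector (Λ := Λ) 1 M,
          (star v ⬝ᵥ gram G Δ μ (ε n) *ᵥ v).re ≤
            (star (φ n) ⬝ᵥ gram G Δ μ (ε n) *ᵥ φ n).re * (star v ⬝ᵥ v).re) →
      ∃ (φl : TensorIndex Λ 2 → ℂ) (g : ℕ → ℕ), StrictMono g ∧
        Tendsto (fun k => φ (g k)) atTop (𝓝 φl) ∧ φl ∈ spinZSector (Λ := Λ) 1 M ∧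
        star φl ⬝ᵥ φl = 1 ∧
        (ham G Δ μ).mulVec φl = ((lowestEnergyInSector 1 (ham G Δ μ) M : ℝ) : ℂ) • φl

/-- STATEMENT 6 (no window needed). Perron–Frobenius uniqueness of the sector ground ray: on a connected
graph, for every `Δ`, `μ`, `M`, the solutions in `𝓗_M` of `Hψ = E_min(M)ψ` form a space of dimension `≤ 1`.
Content: in the `Sᶻ` basis `H` is real symmetric with off-diagonal entries `-½ · [token hop] ≤ 0`
(`J = -1`: `-(SˣSˣ+SʸSʸ) = -½(S⁺S⁻ + S⁻S⁺)`; `ΔSᶻSᶻ` and the fields are diagonal), `𝓗_M` is the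
coordinate subspace of magnetisation-`M` configurations (`mem_spinZSector_iff`), connected under hops
(`TokenSliding.exists_slide_out`), and `E_min(M)` bounds the sector quadratic form from below
(`Matrix.minEnergyOn`); apply `perronFrobenius_groundState_unique` to the sector block. -/
def SectorGroundUnique : Prop :=
  ∀ (Λ : Type) [Fintype Λ] [DecidableEq Λ] (G : SimpleGraph Λ) [DecidableRel G.Adj], G.Connected →
    ∀ (Δ : ℝ) (μ : Λ → ℝ) (M : ℝ) (ψ ψ' : TensorIndex Λ 2 → ℂ),
      ψ ∈ spinZSector (Λ := Λ) 1 M → ψ ≠ 0 →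
      (ham G Δ μ).mulVec ψ = ((lowestEnergyInSector 1 (ham G Δ μ) M : ℝ) : ℂ) • ψ →
      ψ' ∈ spinZSector (Λ := Λ) 1 M →
      (ham G Δ μ).mulVec ψ' = ((lowestEnergyInSector 1 (ham G Δ μ) M : ℝ) : ℂ) • ψ' →
      ∃ c : ℂ, ψ' = c • ψ

/-! ## Registered stubs -/

/-- STUB 1 (M; LOAD-BEARING — the six-vertex / triangle window). See `EulerGateSymbolStable`. -/
theorem stub_eulerGateSymbol : EulerGateSymbolStable := by
  sorry

/-- STUB 2 (M). The Gram sweep preserves stability-or-zero of amplitude families, from STUB 1 through the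
proved kernel form of Borcea–Brändén's Lemma 2.2 and `diagScale`. See `GramPreservesStability`. -/
theorem stub_gramPreserves : EulerGateSymbolStable → GramPreservesStability := by
  sorry

/-- STUB 3 (M). Stoquasticity, positive diagonal, magnetisation blocks and sector irreducibility of the
Gram sweep. See `GramStoquastic`. -/
theorem stub_gramStoquastic : GramStoquastic := by
  sorry

/-- STUB 4 (L; the largest). The sector Perron vector of a nonnegative PSD irreducible stability preserver
is amplitude-stable. See `PerronVectorStable`. -/
theorem stub_perronStable : GramPreservesStability → GramStoquastic → PerronVectorStable := by
  sorry

/-- STUB 5 (M–L). `A_ε = 1 - 2εH + O(ε²)`: top eigenvectors of the Gram sweeps accumulate at sector ground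
vectors of `H` as `ε → 0⁺`. See `PerronLimit`. -/
theorem stub_perronLimit : PerronLimit := by
  sorry

/-- STUB 6 (M). Perron–Frobenius uniqueness of the sector ground ray of the stoquastic `H` on a connected
graph. See `SectorGroundUnique`. -/
theorem stub_sectorGroundUnique : SectorGroundUnique := by
  sorry

/-! ## Name-keyed aliases of the six statements (hypotheses of the composition)

`Registered.stub_X` is the statement of `stub_X` under the registered stub's short name, so that the
native skeleton audit (`#h21_check_skeleton`: hypotheses admissible iff registered obligations / declared
stubs BY NAME) accepts `GroundStateStability_of : Registered.stub_eulerGateSymbol → … → GroundStateStability`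
(device of `CriticalPhenomena/CardyFormulaZ2/Cruxes/LagHandOff/Lines/crosscut-dictionary.lean`). -/
namespace Registered

/-- Alias of `EulerGateSymbolStable` keyed by the registered stub name. -/
abbrev stub_eulerGateSymbol : Prop := EulerGateSymbolStable
/-- Alias of the statement of `stub_gramPreserves`. -/
abbrev stub_gramPreserves : Prop := EulerGateSymbolStable → GramPreservesStability
/-- Alias of `GramStoquastic` keyed by the registered stub name. -/
abbrev stub_gramStoquastic : Prop := GramStoquastic
/-- Alias of the statement of `stub_perronStable`. -/
abbrev stub_perronStable : Prop := GramPreservesStability → GramStoquastic → PerronVectorStable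
/-- Alias of `PerronLimit` keyed by the registered stub name. -/
abbrev stub_perronLimit : Prop := PerronLimit
/-- Alias of `SectorGroundUnique` keyed by the registered stub name. -/
abbrev stub_sectorGroundUnique : Prop := SectorGroundUnique

end Registered

/-! ## Proved glue: configurations, amplitudes, Hurwitz for amplitude families -/

/-- Every configuration is the occupation configuration of its set of up-spins. -/
theorem ind_filter_eq (σ : TensorIndex Λ 2) :
    ind (Finset.univ.filter fun x => σ x = 0) = σ := by
  funext x
  simp only [ind, Finset.mem_filter, Finset.mem_univ, true_and]
  split_ifs with h
  · exact h.symm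
  · apply Fin.ext
    have h1 : (σ x).val ≠ 0 := fun h0 => h (Fin.ext h0)
    have h2 := (σ x).isLt
    rw [Fin.val_one]
    omega

/-- A vector with vanishing amplitude family is zero. -/
theorem eq_zero_of_amp_eq_zero {ψ : TensorIndex Λ 2 → ℂ} (h : ∀ S, amp ψ S = 0) : ψ = 0 := by
  funext σ
  have := h (Finset.univ.filter fun x => σ x = 0)
  simp only [amp] at this
  rwa [ind_filter_eq] at this

omit [Fintype Λ] in
/-- The amplitude map `ψ ↦ amp ψ` is continuous (it is a coordinate projection). -/
theorem continuous_amp : Continuous (fun ψ : TensorIndex Λ 2 → ℂ => amp ψ) :=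
  continuous_pi fun S => continuous_apply (ind S)

/-- **Hurwitz for amplitude families.** A limit of vectors with stable amplitude polynomials has a stable
amplitude polynomial, unless it is zero (multivariate Hurwitz in the continuous-family form
`eq_zero_or_isUpperHalfPlaneStable_of_mem_closure`, through the bridge
`isUpperHalfPlaneStable_multiAffine_iff`). -/
theorem ampStable_of_tendsto {φ : ℕ → TensorIndex Λ 2 → ℂ} {φl : TensorIndex Λ 2 → ℂ}
    (hφ : ∀ k, AmpStable (amp (φ k))) (hlim : Tendsto φ atTop (𝓝 φl)) (h0 : φl ≠ 0) :
    AmpStable (amp φl) := by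
  have hcont : Continuous fun az : (Finset Λ → ℂ) × (Λ → ℂ) =>
      MvPolynomial.eval az.2 (multiAffine az.1) := by
    simp only [eval_multiAffine]
    refine continuous_finsetSum _ fun S _ => ?_
    refine ((continuous_apply S).comp continuous_fst).mul ?_
    exact continuous_finsetProd _ fun i _ => (continuous_apply i).comp continuous_snd
  let s : Set (Finset Λ → ℂ) := {a | IsUpperHalfPlaneStable (multiAffine a)}
  have hs : ∀ a ∈ s, IsUpperHalfPlaneStable (multiAffine a) := fun a ha => ha
  have hlim' : Tendsto (fun k => amp (φ k)) atTop (𝓝 (amp φl)) :=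
    (continuous_amp.tendsto φl).comp hlim
  have hq : amp φl ∈ closure s :=
    mem_closure_of_tendsto hlim'
      (Eventually.of_forall fun k => (isUpperHalfPlaneStable_multiAffine_iff _).2 (hφ k))
  rcases eq_zero_or_isUpperHalfPlaneStable_of_mem_closure (P := multiAffine) hcont hs hq with h | h
  · exact absurd (eq_zero_of_amp_eq_zero ((multiAffine_eq_zero_iff _).1 h)) h0
  · exact (isUpperHalfPlaneStable_multiAffine_iff _).1 h

/-! ## The composition: the six stubs imply the crux, by name -/

/-- **`GroundStateStability` from the six stubs** (no `sorry`). Given the crux's data and a sector ground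
vector `ψ ≠ 0`: STUB 4 (fed by STUBS 1–3) produces, for `εₙ = 1/(n+1)`, unit top eigenvectors `φₙ` of the
Gram sweeps in `𝓗_M` with stable amplitude polynomials; STUB 5 extracts a limit `φ_∞`, a unit sector ground
vector; Hurwitz (`ampStable_of_tendsto`) makes `φ_∞` amplitude-stable; STUB 6 gives `ψ = c φ_∞`, `c ≠ 0`. -/
theorem GroundStateStability_of (h1 : Registered.stub_eulerGateSymbol)
    (h2 : Registered.stub_gramPreserves) (h3 : Registered.stub_gramStoquastic)
    (h4 : Registered.stub_perronStable) (h5 : Registered.stub_perronLimit)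
    (h6 : Registered.stub_sectorGroundUnique) : GroundStateStability := by
  have hP : PerronVectorStable := h4 (h2 h1) h3
  intro Λ _ _ G _ hG Δ μ hΔ M ψ hψ hψ0 hHψ z hz
  -- the sector is nonzero
  have hM : spinZSector (Λ := Λ) 1 M ≠ ⊥ := fun hbot =>
    hψ0 ((Submodule.eq_bot_iff _).1 hbot ψ hψ)
  -- Perron vectors of the Gram sweeps at εₙ = 1/(n+1)
  set ε : ℕ → ℝ := fun n => 1 / ((n : ℝ) + 1) with hε
  have hεpos : ∀ n, 0 < ε n ∧ ε n ≤ 1 := by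
    intro n
    have hn : (0 : ℝ) < (n : ℝ) + 1 := by positivity
    refine ⟨by positivity, ?_⟩
    rw [hε, div_le_one hn]
    linarith [(Nat.cast_nonneg n : (0 : ℝ) ≤ n)]
  have hεlim : Tendsto ε atTop (𝓝 0) := tendsto_one_div_add_atTop_nhds_zero_nat
  choose φ hφ using fun n => hP Λ G hG Δ μ hΔ (ε n) (hεpos n).1 (hεpos n).2 M hM
  obtain ⟨φl, g, _hg, hlim, hsec, hunit, heig⟩ :=
    h5 Λ G Δ μ M ε hεpos hεlim φ fun n => ⟨(hφ n).1, (hφ n).2.2.1, (hφ n).2.2.2.1⟩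
  -- the limit is nonzero and amplitude-stable (Hurwitz)
  have hφl0 : φl ≠ 0 := by
    intro h
    rw [h, star_zero, zero_dotProduct] at hunit
    exact zero_ne_one hunit
  have hstab : AmpStable (amp φl) :=
    ampStable_of_tendsto (fun k => (hφ (g k)).2.2.2.2) hlim hφl0
  -- uniqueness of the sector ground ray: ψ = c • φl
  obtain ⟨c, hc⟩ := h6 Λ G hG Δ μ M φl ψ hsec hφl0 heig hψ hHψ
  have hc0 : c ≠ 0 := by
    rintro rfl
    exact hψ0 (by rw [hc, zero_smul])
  subst hc
  have hsum : (∑ S : Finset Λ, (c • φl) (fun x => if x ∈ S then 0 else 1) * ∏ x ∈ S, z x) =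
      c * ∑ S : Finset Λ, amp φl S * ∏ x ∈ S, z x := by
    rw [Finset.mul_sum]
    refine Finset.sum_congr rfl fun S _ => ?_
    simp only [Pi.smul_apply, smul_eq_mul, mul_assoc]
    rfl
  rw [hsum]
  exact mul_ne_zero hc0 (hstab z hz)

/-- Wiring check: the registered stubs feed `GroundStateStability_of` as stated. -/
example : GroundStateStability :=
  GroundStateStability_of stub_eulerGateSymbol stub_gramPreserves stub_gramStoquastic
    stub_perronStable stub_perronLimit stub_sectorGroundUnique

end Summit.AtomisticToContinuum.BoseEinsteinCondensation.Cruxes.GroundStateStability.SixVertexEulerGates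

end
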